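import Summits.KontsevichZagierPeriods.KontsevichZagierPeriods.Theorems.IsogenyCertificatesXMapKernelStubNonCMClassAux
import Summits.KontsevichZagierPeriods.KontsevichZagierPeriods.Theorems.IsogenyCertificatesXMapKernelStubClassReduction
import Literature.NumberTheory.Transcendental.OnePeriodsProofs

/-!
# `XMapKernel`, line `isogeny-orbit-collapse` — stub **R-b2**: the non-CM class

Support file for the crux `IsogenyCertificates.XMapKernel` (stmt-KontsevichZagierPeriods-10663),
line `isogeny-orbit-collapse`, stub `stub_nonCMClass` (R-b2).

**Statement (R-b2).** Given the `Aut(ℂ)`-rigidity of lattice multipliers (R-b0) and the linear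
independence of positive real radicals (R-b4), both taken as HYPOTHESES, let `L₀` be a lattice
with rational invariants and WITHOUT complex multiplication, and let `S` be a set of nonsingular
integral cubics `Pⱼ = x³ + Aⱼx + Bⱼ` whose period lattices `Λⱼ` (invariants `(−4Aⱼ, −4Bⱼ)`) all
receive a non-zero multiple `αⱼΛ₀ ⊆ Λⱼ` of `Λ₀`, pairwise without rational lattice multiplier.
Then a vanishing rational combination `∑_{j ∈ S} qⱼ Ωⱼ = 0` of the full real periods
`Ωⱼ = ∫_{Pⱼ > 0} dx/√Pⱼ` is trivial.

**Proof.** The lattice-theoretic half is the auxiliary file `…StubNonCMClassAux.lean`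
(`stub_nonCMClass_certificate`): `Hom(Λ₀, Λⱼ) = ℤγⱼ` (no CM, `exists_nat_mul_mem_of_le`),
`σ(γⱼ) = ±γⱼ` for `σ ∈ Aut(ℂ)` (R-b0), hence `αⱼ² ∈ ℚ` and `αⱼ = tⱼ` real or `αⱼ = tⱼi`
purely imaginary; with `u = Ω₀(Λ₀)`, `v = Ω₀(iΛ₀)` (`Λ₀ ∩ ℝ = ℤu`, `Λ₀ ∩ iℝ = ℤiv`) and
`NⱼΛⱼ ⊆ αⱼΛ₀` one gets `Ω₀(Λⱼ) = xⱼ·u` (real type) or `Ω₀(Λⱼ) = xⱼ·v` (imaginary type) with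
`xⱼ = (mⱼ/Nⱼ)tⱼ > 0`, `xⱼ² ∈ ℚ`. Here:
4. *Masser* (`indep_omega`, `indep_real_imag`). By Masser's theorem
   (`masser_ellipticPeriods_holds`, PROVED in the tree) `ω₁, ω₂` of `Λ₀` are `ℚ̄`-linearly
   independent, hence so are the `ℝ`-independent lattice vectors `u, iv` (integer change of
   basis with non-zero determinant): a relation `a·u + b·v = 0` with `a, b ∈ ℚ̄` is trivial.
5. *Splitting and radicals* (`stub_nonCMClass`). With `Ωⱼ = nⱼ Ω₀(Λⱼ)`, `nⱼ ∈ {1, 2}`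
   (`ClassReduction.exists_periodPair`; a lattice with the invariants of `Λⱼ` IS `Λⱼ`,
   `uniformization_unique_holds`), the relation reads
   `(∑_{re} qⱼnⱼxⱼ)·u + (∑_{im} qⱼnⱼxⱼ)·v = 0`, so both brackets vanish by 4. Within one bracket
   the `xⱼ` have pairwise irrational ratios: `xⱼ = r·xⱼ'` (`r ∈ ℚ`) gives `αⱼ = r'αⱼ'` with
   `r' ∈ ℚˣ`, and then `Nⱼ'r'` is a RATIONAL lattice multiplier `Λⱼ' → Λⱼ`
   (`Nⱼ'Λⱼ' ⊆ αⱼ'Λ₀`, `αⱼΛ₀ ⊆ Λⱼ`), excluded by hypothesis. R-b4 with `m = 2`, after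
   re-indexing a bracket by `Fin r` (`Finset.equivFin`), gives `qⱼnⱼ = 0`, hence `qⱼ = 0`.

No definitions, no new named facts; the only transcendence input is Masser's theorem (proved in
the tree); R-b0 and R-b4 enter as hypotheses, verbatim their registered signatures.

References: D. Masser, *Elliptic Functions and Transcendence*, LNM 437 (1975), Ch. II Thm. II;
D. A. Cox, *Primes of the form x² + ny²* (2013), §10.C; J. H. Silverman, *The Arithmetic of
Elliptic Curves* (2009), Thm. VI.5.1, C.16; L. J. Mordell, Pacific J. Math. 3 (1953), Thm. 1.
-/

noncomputable section

namespace Summit.KontsevichZagierPeriods.IsogenyCertificates.XMapKernelStubs.NonCMClass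

open scoped BigOperators ComplexConjugate
open Complex Literature.NumberTheory.Transcendental
open Summit.KontsevichZagierPeriods.IsogenyCertificates.EffectiveXMapChainsNegative

/-! ## §4 Masser: `u = Ω₀(Λ₀)` and `iv`, `v = Ω₀(iΛ₀)`, are `ℚ̄`-linearly independent -/

/-- **Masser, two-period form.** For a lattice with algebraic invariants and no complex
multiplication, `ω₁, ω₂` are linearly independent over `ℚ̄` (sub-family of Masser's six numbers
`1, 2πi, ω₁, ω₂, η₁, η₂`, `masser_ellipticPeriods_holds`). [cite: Masser1975, Ch. II Thm. II] -/
theorem indep_omega {L₀ : PeriodPair} (h₂ : IsAlgebraic ℚ L₀.g₂) (h₃ : IsAlgebraic ℚ L₀.g₃)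
    (hCM : ¬ L₀.HasCM) {c₁ c₂ : ℂ} (hc₁ : IsAlgebraic ℚ c₁) (hc₂ : IsAlgebraic ℚ c₂)
    (h : c₁ * L₀.ω₁ + c₂ * L₀.ω₂ = 0) : c₁ = 0 ∧ c₂ = 0 := by
  have hM := masser_ellipticPeriods_holds L₀ h₂ h₃ hCM
  have hβ : ∀ i, IsAlgebraic ℚ ((![0, 0, c₁, c₂, 0, 0] : Fin 6 → ℂ) i) := by
    intro i
    fin_cases i
    · exact isAlgebraic_zero
    · exact isAlgebraic_zero
    · exact hc₁
    · exact hc₂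
    · exact isAlgebraic_zero
    · exact isAlgebraic_zero
  have hs : ∑ i, (![0, 0, c₁, c₂, 0, 0] : Fin 6 → ℂ) i *
      ![1, 2 * Real.pi * I, L₀.ω₁, L₀.ω₂, L₀.η₁, L₀.η₂] i = 0 := by
    rw [Fin.sum_univ_six]
    show 0 * 1 + 0 * (2 * Real.pi * I) + c₁ * L₀.ω₁ + c₂ * L₀.ω₂ + 0 * L₀.η₁ + 0 * L₀.η₂ = 0
    rw [zero_mul, zero_mul, zero_mul, zero_mul, zero_add, zero_add, add_zero, add_zero]
    exact h
  have h6 := hM _ hβ hs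
  exact ⟨h6 2, h6 3⟩

/-- **`u` and `iv` are `ℚ̄`-independent.** For a real lattice `Λ₀` with rational invariants and
no complex multiplication, with `u = Ω₀(Λ₀)` and `v = Ω₀(iΛ₀)` (so `u, iv ∈ Λ₀` are
`ℝ`-independent lattice vectors), a relation `a·u + b·v = 0` with `a, b` algebraic is trivial:
write `u, iv` in the basis `ω₁, ω₂` (integer matrix of non-zero determinant) and apply
`indep_omega` to `a·u + (−ib)·(iv) = 0`. [cite: Masser1975, Ch. II Thm. II] -/
theorem indep_real_imag {L₀ : PeriodPair} (h₂ : ∃ q : ℚ, (q : ℂ) = L₀.g₂)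
    (h₃ : ∃ q : ℚ, (q : ℂ) = L₀.g₃) (hCM : ¬ L₀.HasCM) (hreal : L₀.IsReal) {a b : ℂ}
    (ha : IsAlgebraic ℚ a) (hb : IsAlgebraic ℚ b)
    (hab : a * L₀.minRealPeriod + b * (L₀.mulLeft I I_ne_zero).minRealPeriod = 0) :
    a = 0 ∧ b = 0 := by
  have hu : 0 < L₀.minRealPeriod := hreal.minRealPeriod_pos
  have hv : 0 < (L₀.mulLeft I I_ne_zero).minRealPeriod := hreal.mulLeft_I.minRealPeriod_pos
  have humem : ((L₀.minRealPeriod : ℝ) : ℂ) ∈ L₀.lattice := hreal.minRealPeriod_mem_lattice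
  have hvmem : I * ((L₀.mulLeft I I_ne_zero).minRealPeriod : ℂ) ∈ L₀.lattice := by
    have h1 := hreal.mulLeft_I.minRealPeriod_mem_lattice
    rw [PeriodPair.mem_mulLeft_lattice, inv_I, neg_mul] at h1
    have h2 := neg_mem h1
    rwa [neg_neg] at h2
  obtain ⟨m₁, n₁, e₁⟩ := PeriodPair.mem_lattice.1 humem
  obtain ⟨m₂, n₂, e₂⟩ := PeriodPair.mem_lattice.1 hvmem
  have ha₂ : IsAlgebraic ℚ L₀.g₂ := by
    obtain ⟨r, hr⟩ := h₂
    rw [← hr]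
    exact isAlgebraic_algebraMap r
  have ha₃ : IsAlgebraic ℚ L₀.g₃ := by
    obtain ⟨r, hr⟩ := h₃
    rw [← hr]
    exact isAlgebraic_algebraMap r
  have hI : IsAlgebraic ℚ I := by
    refine IsAlgebraic.of_pow (r := I) (n := 2) (by norm_num) ?_
    rw [I_sq]
    exact isAlgebraic_one.neg
  -- the relation in the basis `ω₁, ω₂`
  have hrel : (a * m₁ + -I * b * m₂) * L₀.ω₁ + (a * n₁ + -I * b * n₂) * L₀.ω₂ = 0 := by
    have e : (a * m₁ + -I * b * m₂) * L₀.ω₁ + (a * n₁ + -I * b * n₂) * L₀.ω₂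
        = a * ((m₁ : ℂ) * L₀.ω₁ + n₁ * L₀.ω₂) - I * b * ((m₂ : ℂ) * L₀.ω₁ + n₂ * L₀.ω₂) := by
      ring
    rw [e, e₁, e₂]
    linear_combination hab - b * ((L₀.mulLeft I I_ne_zero).minRealPeriod : ℂ) * I_mul_I
  obtain ⟨hA, hB⟩ := indep_omega ha₂ ha₃ hCM
    ((ha.mul (isAlgebraic_int m₁)).add ((hI.neg.mul hb).mul (isAlgebraic_int m₂)))
    ((ha.mul (isAlgebraic_int n₁)).add ((hI.neg.mul hb).mul (isAlgebraic_int n₂))) hrel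
  -- the determinant of `(u, iv)` in the basis `(ω₁, ω₂)` is non-zero
  have hD : (m₁ : ℂ) * n₂ - n₁ * m₂ ≠ 0 := by
    intro hD
    have f₁ : (n₂ : ℂ) * L₀.minRealPeriod - n₁ * (I * (L₀.mulLeft I I_ne_zero).minRealPeriod)
        = 0 := by
      have e : (n₂ : ℂ) * L₀.minRealPeriod - n₁ * (I * (L₀.mulLeft I I_ne_zero).minRealPeriod)
          = ((m₁ : ℂ) * n₂ - n₁ * m₂) * L₀.ω₁ := by
        rw [← e₁, ← e₂]; ring
      rw [e, hD, zero_mul]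
    have f₂ : (m₂ : ℂ) * L₀.minRealPeriod - m₁ * (I * (L₀.mulLeft I I_ne_zero).minRealPeriod)
        = 0 := by
      have e : (m₂ : ℂ) * L₀.minRealPeriod - m₁ * (I * (L₀.mulLeft I I_ne_zero).minRealPeriod)
          = -((m₁ : ℂ) * n₂ - n₁ * m₂) * L₀.ω₂ := by
        rw [← e₁, ← e₂]; ring
      rw [e, hD, neg_zero, zero_mul]
    have g₁ : (n₁ : ℝ) * (L₀.mulLeft I I_ne_zero).minRealPeriod = 0 := by
      have := congrArg Complex.im f₁
      simp only [sub_im, mul_im, intCast_re, intCast_im, ofReal_re, ofReal_im, I_re, I_im,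
        mul_re, zero_im] at this
      linarith
    have g₂ : (m₁ : ℝ) * (L₀.mulLeft I I_ne_zero).minRealPeriod = 0 := by
      have := congrArg Complex.im f₂
      simp only [sub_im, mul_im, intCast_re, intCast_im, ofReal_re, ofReal_im, I_re, I_im,
        mul_re, zero_im] at this
      linarith
    have hn₁ : n₁ = 0 := by exact_mod_cast (mul_eq_zero.1 g₁).resolve_right hv.ne'
    have hm₁ : m₁ = 0 := by exact_mod_cast (mul_eq_zero.1 g₂).resolve_right hv.ne'
    rw [hn₁, hm₁, Int.cast_zero, zero_mul, zero_mul, zero_add] at e₁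
    exact hu.ne' (by exact_mod_cast e₁.symm)
  have haD : a * ((m₁ : ℂ) * n₂ - n₁ * m₂) = 0 := by
    linear_combination (n₂ : ℂ) * hA - (m₂ : ℂ) * hB
  have hbD : -I * b * ((m₁ : ℂ) * n₂ - n₁ * m₂) = 0 := by
    linear_combination (m₁ : ℂ) * hB - (n₁ : ℂ) * hA
  refine ⟨(mul_eq_zero.1 haD).resolve_right hD, ?_⟩
  exact (mul_eq_zero.1 ((mul_eq_zero.1 hbD).resolve_right hD)).resolve_left
    (neg_ne_zero.2 I_ne_zero)

/-! ## §5 The stub -/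

/-- **R-b2 — the non-CM class.** Given `Aut(ℂ)`-rigidity of lattice multipliers (R-b0) and the
linear independence of positive real radicals (R-b4) as hypotheses: a vanishing `ℚ`-combination
`∑_{j ∈ S} qⱼ Ωⱼ = 0` of full real periods `Ωⱼ = ∫_{Pⱼ > 0} dx/√Pⱼ` of nonsingular integral cubics
`Pⱼ = x³ + Aⱼx + Bⱼ`, supported on curves whose period lattices `Λⱼ` (invariants
`(−4Aⱼ, −4Bⱼ)`) all receive a non-zero multiple of ONE lattice `Λ₀` with rational invariants
and no complex multiplication, pairwise without rational lattice multiplier, is trivial. Proof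
in the module docstring: `Hom(Λ₀, Λⱼ) = ℤγⱼ` (no CM), `σ(γⱼ) = ±γⱼ` (rigidity) so `αⱼ² ∈ ℚ` and
`αⱼ` is real or purely imaginary, `Ω₀(Λⱼ) ∈ ℚ·αⱼ·u` or `ℚ·(αⱼ/i)·v`
(`stub_nonCMClass_certificate`, auxiliary file), Masser's `ℚ̄`-independence of `u, iv`
(`indep_real_imag`) splits the relation into a real-type and an imaginary-type bracket, and
in each bracket R-b4 (`m = 2`) applies because a rational ratio `xⱼ/xⱼ'` would produce a
rational lattice multiplier `Nⱼ'αⱼ/αⱼ' : Λⱼ' → Λⱼ`.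
[cite: Masser1975, Ch. II Thm. II] -/
theorem stub_nonCMClass : (∀ (L L' : PeriodPair) (γ : ℂ) (σ : ℂ ≃+* ℂ), (∃ q : ℚ, (q : ℂ) = L.g₂) → (∃ q : ℚ, (q : ℂ) = L.g₃) → (∃ q : ℚ, (q : ℂ) = L'.g₂) → (∃ q : ℚ, (q : ℂ) = L'.g₃) → γ ≠ 0 → (∀ l ∈ L.lattice, γ * l ∈ L'.lattice) → ∀ l ∈ L.lattice, σ γ * l ∈ L'.lattice) → (∀ (m : ℕ), 0 < m → ∀ (r : ℕ) (x : Fin r → ℝ) (c : Fin r → ℚ), (∀ j, 0 < x j) → (∀ j, ∃ a : ℚ, x j ^ m = (a : ℝ)) → (∀ j j', j ≠ j' → ¬ ∃ a : ℚ, x j = (a : ℝ) * x j') → ∑ j, (c j : ℝ) * x j = 0 → ∀ j, c j = 0) → ∀ (k : ℕ) (A B : Fin k → ℤ) (q : Fin k → ℚ) (S : Finset (Fin k)) (L₀ : PeriodPair), (∀ i, 4 * A i ^ 3 + 27 * B i ^ 2 ≠ 0) → (∃ q₀ : ℚ, (q₀ : ℂ) = L₀.g₂) → (∃ q₀ : ℚ,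 (q₀ : ℂ) = L₀.g₃) → ¬ L₀.HasCM → (∀ j ∈ S, ∃ (L' : PeriodPair) (α : ℂ), L'.g₂ = -4 * (A j : ℂ) ∧ L'.g₃ = -4 * (B j : ℂ) ∧ α ≠ 0 ∧ ∀ l ∈ L₀.lattice, α * l ∈ L'.lattice) → (∀ i ∈ S, ∀ j ∈ S, i ≠ j → ¬ ∃ (L L' : PeriodPair) (c : ℚ), L.g₂ = -4 * (A i : ℂ) ∧ L.g₃ = -4 * (B i : ℂ) ∧ L'.g₂ = -4 * (A j : ℂ) ∧ L'.g₃ = -4 * (B j : ℂ) ∧ c ≠ 0 ∧ ∀ l ∈ L.lattice, (c : ℂ) * l ∈ L'.lattice) → ∑ j ∈ S, (q j : ℝ) * (∫ x in {x : Fin 1 → ℝ | 0 < x 0 ^ 3 + (A j : ℝ) * x 0 + (B j : ℝ)}, 1 / Real.sqrt (x 0 ^ 3 + (A j : ℝ) * x 0 + (B j : ℝ))) = 0 → ∀ j ∈ S, q j = 0 := by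
  intro hRig hLIR k A B q S L₀ hns hg₂ hg₃ hCM hmem hnrm hsum
  classical
  -- (0) the real period lattices `Λⱼ`, the numbers of real components `nⱼ ∈ {1, 2}`
  choose L hLg₂ hLg₃ hLreal hLΩ using fun j => ClassReduction.exists_periodPair (hns j)
  obtain ⟨n, hn⟩ : ∃ n : Fin k → ℕ, ∀ j, (curve (A j) (B j)).numRealComponents = n j :=
    ⟨_, fun j => rfl⟩
  have hn0 : ∀ j, n j ≠ 0 := fun j => by
    rw [← hn]
    exact (curve (A j) (B j)).numRealComponents_pos.ne'
  have hLg₂' : ∀ j, ∃ r : ℚ, (r : ℂ) = (L j).g₂ := fun j =>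
    ⟨-4 * A j, by rw [hLg₂]; push_cast; ring⟩
  have hLg₃' : ∀ j, ∃ r : ℚ, (r : ℂ) = (L j).g₃ := fun j =>
    ⟨-4 * B j, by rw [hLg₃]; push_cast; ring⟩
  -- (1) the multipliers `αⱼΛ₀ ⊆ Λⱼ` (a lattice with the invariants of `Λⱼ` is `Λⱼ`)
  have hmem' : ∀ j ∈ S, ∃ α : ℂ, α ≠ 0 ∧ ∀ l ∈ L₀.lattice, α * l ∈ (L j).lattice := by
    intro j hj
    obtain ⟨L', α, h₂, h₃, hα, hαL⟩ := hmem j hj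
    have hlat : L'.lattice = (L j).lattice :=
      PeriodPair.uniformization_unique_holds L' (L j) (h₂.trans (hLg₂ j).symm)
        (h₃.trans (hLg₃ j).symm)
    exact ⟨α, hα, fun l hl => hlat ▸ hαL l hl⟩
  choose! α hα0 hαL using hmem'
  -- rigidity, specialised to `Λ₀ → Λⱼ` (all invariants are rational)
  have hRig' : ∀ j, ∀ (γ : ℂ) (σ : ℂ ≃+* ℂ), γ ≠ 0 →
      (∀ l ∈ L₀.lattice, γ * l ∈ (L j).lattice) → ∀ l ∈ L₀.lattice, σ γ * l ∈ (L j).lattice :=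
    fun j γ σ hγ hγL => hRig L₀ (L j) γ σ hg₂ hg₃ (hLg₂' j) (hLg₃' j) hγ hγL
  -- (2) `Λ₀` is real; `u = Ω₀(Λ₀) > 0`, `v = Ω₀(iΛ₀) > 0`
  have hreal₀ : L₀.IsReal := by
    obtain ⟨r₂, hr₂⟩ := hg₂
    obtain ⟨r₃, hr₃⟩ := hg₃
    exact PeriodPair.isReal_of_g₂_g₃_real PeriodPair.uniformization_unique_holds
      (by rw [← hr₂]; exact ratCast_im r₂) (by rw [← hr₃]; exact ratCast_im r₃)
  have hu : 0 < L₀.minRealPeriod := hreal₀.minRealPeriod_pos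
  have hv : 0 < (L₀.mulLeft I I_ne_zero).minRealPeriod := hreal₀.mulLeft_I.minRealPeriod_pos
  -- (3) the certificates of the multipliers
  have hcert : ∀ j ∈ S, ∃ (N : ℕ) (t : ℝ) (e : ℚ) (m : ℤ), N ≠ 0 ∧ t ≠ 0 ∧ t ^ 2 = (e : ℝ) ∧
      (∀ y ∈ (L j).lattice, (N : ℂ) * ((α j)⁻¹ * y) ∈ L₀.lattice) ∧
      (((α j).im = 0 ∧ α j = t ∧ (L j).minRealPeriod = m / N * t * L₀.minRealPeriod) ∨
        ((α j).im ≠ 0 ∧ α j = t * I ∧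
          (L j).minRealPeriod = m / N * t * (L₀.mulLeft I I_ne_zero).minRealPeriod)) :=
    fun j hj =>
      stub_nonCMClass_certificate L₀ (L j) (hRig' j) hCM hreal₀ (hLreal j) (α j) (hα0 j hj)
        (hαL j hj)
  choose! N t e m hN ht hte hNL hcase using hcert
  -- the positive radicals `xⱼ = (mⱼ/Nⱼ)·tⱼ`, the scale `gⱼ ∈ {u, v}` and the carrier `ξⱼ ∈ {1, i}`
  obtain ⟨x, hx⟩ : ∃ x : Fin k → ℝ, ∀ j, x j = (m j : ℝ) / N j * t j := ⟨_, fun j => rfl⟩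
  obtain ⟨g, hg⟩ : ∃ g : Fin k → ℝ, ∀ j,
      g j = if (α j).im = 0 then L₀.minRealPeriod else (L₀.mulLeft I I_ne_zero).minRealPeriod :=
    ⟨_, fun j => rfl⟩
  obtain ⟨ξ, hξ⟩ : ∃ ξ : Fin k → ℂ, ∀ j, ξ j = if (α j).im = 0 then 1 else I := ⟨_, fun j => rfl⟩
  have hgpos : ∀ j, 0 < g j := fun j => by
    rw [hg]
    split_ifs
    · exact hu
    · exact hv
  have hw : ∀ j ∈ S, (L j).minRealPeriod = x j * g j := by
    intro j hj
    rcases hcase j hj with ⟨hp, -, hwj⟩ | ⟨hp, -, hwj⟩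
    · rw [hwj, hx, hg, if_pos hp]
    · rw [hwj, hx, hg, if_neg hp]
  have hαξ : ∀ j ∈ S, α j = t j * ξ j := by
    intro j hj
    rcases hcase j hj with ⟨hp, hαj, -⟩ | ⟨hp, hαj, -⟩
    · rw [hξ, if_pos hp, mul_one]
      exact hαj
    · rw [hξ, if_neg hp]
      exact hαj
  have hxpos : ∀ j ∈ S, 0 < x j := fun j hj => by
    have h1 := (hLreal j).minRealPeriod_pos
    rw [hw j hj] at h1
    exact pos_of_mul_pos_left h1 (hgpos j).le
  have hxsq : ∀ j ∈ S, ∃ a : ℚ, x j ^ 2 = (a : ℝ) := fun j hj =>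
    ⟨((m j : ℚ) / N j) ^ 2 * e j, by rw [hx]; push_cast; rw [← hte j hj]; ring⟩
  have hxalg : ∀ j ∈ S, IsAlgebraic ℚ (x j : ℂ) := by
    intro j hj
    obtain ⟨a, ha⟩ := hxsq j hj
    refine IsAlgebraic.of_pow (n := 2) (by norm_num) ?_
    have h1 : (x j : ℂ) ^ 2 = (a : ℂ) := by
      rw [← ofReal_ratCast]
      exact_mod_cast congrArg ((↑) : ℝ → ℂ) ha
    rw [h1]
    exact isAlgebraic_algebraMap a
  -- (4) the relation `∑_{j ∈ S} (qⱼ nⱼ) xⱼ gⱼ = 0` and its splitting by type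
  obtain ⟨c, hc⟩ : ∃ c : Fin k → ℚ, ∀ j, c j = q j * n j := ⟨_, fun j => rfl⟩
  have hrel : ∑ j ∈ S, (c j : ℝ) * x j * g j = 0 := by
    simp only [hLΩ, hn] at hsum
    rw [← hsum]
    refine Finset.sum_congr rfl fun j hj => ?_
    rw [hw j hj, hc]
    push_cast
    ring
  have hsplit := Finset.sum_filter_add_sum_filter_not S (fun j => (α j).im = 0)
    (fun j => (c j : ℝ) * x j * g j)
  have hre_sum : ∑ j ∈ S.filter (fun j => (α j).im = 0), (c j : ℝ) * x j * g j
      = (∑ j ∈ S.filter (fun j => (α j).im = 0), (c j : ℝ) * x j) * L₀.minRealPeriod := by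
    rw [Finset.sum_mul]
    refine Finset.sum_congr rfl fun j hj => ?_
    rw [hg, if_pos (Finset.mem_filter.1 hj).2]
  have him_sum : ∑ j ∈ S.filter (fun j => ¬ (α j).im = 0), (c j : ℝ) * x j * g j
      = (∑ j ∈ S.filter (fun j => ¬ (α j).im = 0), (c j : ℝ) * x j) *
          (L₀.mulLeft I I_ne_zero).minRealPeriod := by
    rw [Finset.sum_mul]
    refine Finset.sum_congr rfl fun j hj => ?_
    rw [hg, if_neg (Finset.mem_filter.1 hj).2]
  have hab : (∑ j ∈ S.filter (fun j => (α j).im = 0), (c j : ℝ) * x j) * L₀.minRealPeriod +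
      (∑ j ∈ S.filter (fun j => ¬ (α j).im = 0), (c j : ℝ) * x j) *
        (L₀.mulLeft I I_ne_zero).minRealPeriod = 0 := by
    rw [← hre_sum, ← him_sum, hsplit, hrel]
  -- (5) Masser: both brackets vanish
  have halg : ∀ T : Finset (Fin k), T ⊆ S →
      IsAlgebraic ℚ ((∑ j ∈ T, (c j : ℝ) * x j : ℝ) : ℂ) := by
    intro T hTS
    push_cast
    exact (Subalgebra.algebraicClosure ℚ ℂ).sum_mem fun j hj =>
      ((isAlgebraic_algebraMap (c j)).mul (hxalg j (hTS hj)) :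
        (c j : ℂ) * (x j : ℂ) ∈ Subalgebra.algebraicClosure ℚ ℂ)
  obtain ⟨ha0, hb0⟩ := indep_real_imag hg₂ hg₃ hCM hreal₀
    (halg _ (Finset.filter_subset _ _)) (halg _ (Finset.filter_subset _ _))
    (by exact_mod_cast hab)
  have ha0' : ∑ j ∈ S.filter (fun j => (α j).im = 0), (c j : ℝ) * x j = 0 := by
    exact_mod_cast ha0
  have hb0' : ∑ j ∈ S.filter (fun j => ¬ (α j).im = 0), (c j : ℝ) * x j = 0 := by
    exact_mod_cast hb0
  -- (6) within one type the `xⱼ` have pairwise irrational ratios (no rational multiplier)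
  have hirr : ∀ j ∈ S, ∀ j' ∈ S, j ≠ j' → ξ j = ξ j' → ¬ ∃ r : ℚ, x j = (r : ℝ) * x j' := by
    rintro j hj j' hj' hne hξξ ⟨r, hr⟩
    have hmj : (m j : ℝ) ≠ 0 := by
      intro h0
      have := hxpos j hj
      rw [hx, h0, zero_div, zero_mul] at this
      exact lt_irrefl _ this
    have hNj : (N j : ℝ) ≠ 0 := by exact_mod_cast hN j hj
    have hαj' : α j' ≠ 0 := hα0 j' hj'
    -- `tⱼ = r'·tⱼ'` with `r' ∈ ℚ`
    have htt : t j = ((r * ((m j' : ℚ) / N j') * ((N j : ℚ) / m j) : ℚ) : ℝ) * t j' := by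
      have e1 : t j = (N j : ℝ) / m j * ((m j : ℝ) / N j * t j) := by field_simp
      rw [e1, ← hx, hr, hx]
      push_cast
      ring
    set r' : ℚ := r * ((m j' : ℚ) / N j') * ((N j : ℚ) / m j) with hr'_def
    have hr'0 : r' ≠ 0 := by
      intro h0
      apply ht j hj
      rw [htt, h0, Rat.cast_zero, zero_mul]
    -- hence `αⱼ = r'·αⱼ'`, and `Nⱼ'·r'` is a rational multiplier `Λⱼ' → Λⱼ`
    have hαα : α j = (r' : ℂ) * α j' := by
      rw [hαξ j hj, hαξ j' hj', hξξ, htt]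
      push_cast
      ring
    refine hnrm j' hj' j hj hne.symm ⟨L j', L j, (N j' : ℚ) * r', hLg₂ j', hLg₃ j', hLg₂ j,
      hLg₃ j, mul_ne_zero (by exact_mod_cast hN j' hj') hr'0, fun l hl => ?_⟩
    have h2 := hαL j hj _ (hNL j' hj' l hl)
    have e2 : (((N j' : ℚ) * r' : ℚ) : ℂ) * l = α j * ((N j' : ℂ) * ((α j')⁻¹ * l)) := by
      rw [hαα]
      push_cast
      field_simp
    rw [e2]
    exact h2
  -- (7) radical independence (R-b4, `m = 2`) on one type
  have hLIRapp : ∀ T : Finset (Fin k), T ⊆ S → (∀ j ∈ T, ∀ j' ∈ T, ξ j = ξ j') →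
      ∑ j ∈ T, (c j : ℝ) * x j = 0 → ∀ j ∈ T, q j = 0 := by
    intro T hTS hξT hT j hj
    set eT := T.equivFin with heT
    have key := hLIR 2 two_pos T.card (fun i => x (eT.symm i)) (fun i => c (eT.symm i))
      (fun i => hxpos _ (hTS (eT.symm i).2)) (fun i => hxsq _ (hTS (eT.symm i).2))
      (fun i i' hii' => hirr _ (hTS (eT.symm i).2) _ (hTS (eT.symm i').2)
        (fun h => hii' (eT.symm.injective (Subtype.ext h)))
        (hξT _ (eT.symm i).2 _ (eT.symm i').2))
      (by
        calc ∑ i, ((c (eT.symm i) : ℚ) : ℝ) * x (eT.symm i)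
            = ∑ y : {y // y ∈ T}, ((c y : ℚ) : ℝ) * x y :=
              eT.symm.sum_comp (fun y : {y // y ∈ T} => ((c y : ℚ) : ℝ) * x y)
          _ = ∑ y ∈ T, ((c y : ℚ) : ℝ) * x y :=
              Finset.sum_coe_sort T (fun y => ((c y : ℚ) : ℝ) * x y)
          _ = 0 := hT)
    have hcj := key (eT ⟨j, hj⟩)
    simp only [Equiv.symm_apply_apply] at hcj
    rw [hc] at hcj
    rcases mul_eq_zero.1 hcj with h | h
    · exact h
    · exact absurd (by exact_mod_cast h) (hn0 j)
  -- (8) conclusion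
  intro j hj
  by_cases hp : (α j).im = 0
  · refine hLIRapp (S.filter fun j => (α j).im = 0) (Finset.filter_subset _ _) ?_ ha0' j
      (Finset.mem_filter.2 ⟨hj, hp⟩)
    intro i hi i' hi'
    rw [hξ, hξ, if_pos (Finset.mem_filter.1 hi).2, if_pos (Finset.mem_filter.1 hi').2]
  · refine hLIRapp (S.filter fun j => ¬ (α j).im = 0) (Finset.filter_subset _ _) ?_ hb0' j
      (Finset.mem_filter.2 ⟨hj, hp⟩)
    intro i hi i' hi'
    rw [hξ, hξ, if_neg (Finset.mem_filter.1 hi).2, if_neg (Finset.mem_filter.1 hi').2]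

end Summit.KontsevichZagierPeriods.IsogenyCertificates.XMapKernelStubs.NonCMClass
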